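import Summits.ResolutionOfSingularities.ResolutionOfSingularities.Theorems.EquisingularLiftEquisingularLiftNatMemberSStepRegular
import Summits.ResolutionOfSingularities.ResolutionOfSingularities.Theorems.EquisingularLiftEquisingularLiftNatSubchainSupplierInvSLDefs
import Summits.ResolutionOfSingularities.ResolutionOfSingularities.Theorems.EquisingularLiftEquisingularLiftNatConeRoundCartier
import Summits.ResolutionOfSingularities.ResolutionOfSingularities.Theorems.EquisingularLiftEquisingularLiftNatCarrierDeltaHDeltaTC3
import Summits.ResolutionOfSingularities.ResolutionOfSingularities.Theorems.EquisingularLiftEquisingularLiftNatFatTouchNotFinishing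
import Summits.ResolutionOfSingularities.ResolutionOfSingularities.Theorems.EquisingularLiftEquisingularLiftNatCarrierPairStrictTransformRegular
import Summits.ResolutionOfSingularities.ResolutionOfSingularities.Theorems.EquisingularLiftEquisingularLiftNatStrictTransformSupport
import Summits.ResolutionOfSingularities.ResolutionOfSingularities.Theorems.EquisingularLiftEquisingularLiftSectionKer
import Summits.ResolutionOfSingularities.ResolutionOfSingularities.Theorems.EquisingularLiftEquisingularLiftNatTCPlusMemberUncentred
import Literature.AlgebraicGeometry.Resolution.RegularBlowup
import Literature.AlgebraicGeometry.Resolution.KollarMaxContactChartsFieldChange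
import HarnessLib

/-!
# (H4-T) A model-carrying LETTER through the section steps to a model-carrying letter

[OURS · L1 W4.5b · T23-A⁗ «initial-stage hyperplane letters» · brick (H4-T) of the crux chain w45b, EL♮(3)
stmt-ResolutionOfSingularities-20148; res-L1-w45b-stub-2, TAKEN from res-type-027's offer 2026-08-28T12:46:02Z; desk ruling
2026-08-28T13:10:28Z] — NOT a statement of the manuscript [Hironaka2017]; counted 0; AI kernel work weaker than expert review.

At an explicit stage `σ' : X' → P` of the tower (model square `j : F₁ → X'` over `Spec θ`, `O ↠ k` a complete DVR quotient), with the
section `s : Spec O → X'` through `s(s₀) = j x`, the section blow-up `τ₁ : X₁ → X'` of `ker s` over the point blow-up `υ : F₂ → F₁`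
of `x` (`j₂ ≫ τ₁ = υ ≫ j`), let `𝓛` be a LETTER at `(X', σ', j)` in the sense of `TCPlus.LetterDatum` — (l-i) reduced trace
`𝓛·𝒪_{F₁} = 𝓘⟨closure L₁⟩`, (l-ii) stalkwise principal, (l-iii) `V(𝓛)` regular, (l-iv) `σ'(supp 𝓛)` off the generic point of
`Y`, (l-v) `V(𝓛) → Spec O` flat — which CONTAINS THE SECTION (`𝓛 ≤ ker s`) and is not the whole fibre (`closure L₁ ≠ F₁`).
Then its strict transform `St_{τ₁} 𝓛` is a letter at `(X₁, τ₁ ≫ σ', j₂)` with trace `closure υ⁻¹(L₁ ∖ {x})`: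

* (l-i) `(St 𝓛)·𝒪_{F₂} = St_υ(𝓛·𝒪_{F₁}) = 𝓘⟨closure υ⁻¹(closure L₁ ∖ {x})⟩`: the single-letter case of the carrier-alone
  exactness `comap_strictTransformIdeal_carrier_eq_of_regularPoint` — a section frame `c` at `j x`
  (`exists_sectionFrame_forall_dim_at`), the local equation `h` of `𝓛` lies in `(c)` (`𝓛 ≤ ker s`) and has ORDER ONE because
  `𝒪_{X',j x}/(h)` is regular (`V(𝓛)` regular; Matsumura 14.2), so `h = Φ(c)` for a linear form `Φ` alive modulo `(c)` and
  modulo `(c̄)` downstairs (`exists_linearForm_conePack`), and F⁺5 `comap_strictTransformIdeal_eq_of_model` applies; then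
  `strictTransformIdeal_vanishingIdeal_eq` and `closure_preimage_closure_diff_singleton` downstairs;
* (l-ii) `isPrincipal_stalkIdeal_strictTransformIdeal` (regular centre, principal stalks);
* (l-iii) `V(St 𝓛) → V(𝓛)` is the blow-up of the regular `V(𝓛)` along `(ker s)·𝒪_{V(𝓛)}`
  (`isBlowup_subscheme_strictTransformIdeal_of_idealSheaf`), whose centre `V((ker s)·𝒪_{V(𝓛)}) ≅ V(ker s) ≅ Spec O` is regular
  (`isRegular_subscheme_comap_subschemeι_of_le`), hence regular (`IsBlowup.isRegular_of_isRegular_subscheme`, Liu 8.1.19 (a));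
* (l-iv) `supp St 𝓛 ⊆ closure τ₁⁻¹(supp 𝓛 ∖ supp ker s) ⊆ τ₁⁻¹(supp 𝓛)` (`support_strictTransformIdeal_subset`);
* (l-v) T-STFLAT-GEN `flat_strictTransform_subschemeι_comp_stage`.

[cite: GortzWedhorn2020, Prop. 13.91 and (13.19)] [cite: Liu2002, Thm. 8.1.19 (a)] [cite: Matsumura1987, Thm. 14.2]
-/

set_option linter.dupNamespace false -- mandated namespace `Summit.<Summit>.<Problem>` of this single-conjunct summit
set_option linter.overlappingInstances false -- signatures carry `[IsDomain O] [IsDiscreteValuationRing O]`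

noncomputable section

open CategoryTheory CategoryTheory.Limits AlgebraicGeometry TopologicalSpace Topology IsLocalRing
open Literature.AlgebraicGeometry.Resolution
open AlgebraicGeometry.Scheme.IdealSheafData
open Summit.ResolutionOfSingularities.ResolutionOfSingularities.Cruxes.EquisingularLift.StrataSplit

namespace Summit.ResolutionOfSingularities.ResolutionOfSingularities.Cruxes.EquisingularLiftNat.Sections

/-- **(H4-T), explicit clauses.** For a letter `𝓛` at `(X', σ', j)` with trace `closure L₁ ≠ F₁` containing the section
(`𝓛 ≤ ker s`), the strict transform `St_{τ₁} 𝓛` under the section blow-up satisfies the five `TCPlus.LetterDatum` clauses at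
`(X₁, τ₁ ≫ σ', j₂)` with trace `closure υ⁻¹(L₁ ∖ {x})`. [cite: GortzWedhorn2020, Prop. 13.91] [cite: Liu2002, Thm. 8.1.19 (a)]
[cite: Matsumura1987, Thm. 14.2] [OURS · L1 W4.5b · T23-A⁗ (H4-T)] helper toward stmt-ResolutionOfSingularities-20148; NOT a
statement of the manuscript. -/
theorem letter_strictTransform_clauses_of_le_ker (k : Type) [Field k] (O : Type) [CommRing O] [IsDomain O]
    [IsDiscreteValuationRing O] (θ : O →+* k) (hθ : Function.Surjective θ) (P : Scheme.{0}) (q : P ⟶ Spec (.of O)) (Y : Set P)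
    (X' : Scheme.{0}) (σ' : X' ⟶ P) [IsIntegral X'] [IsLocallyNoetherian X'] [IsSeparated (σ' ≫ q)] (hX'reg : Scheme.IsRegular X')
    (F₁ : Scheme.{0}) [IsIntegral F₁] (j : F₁ ⟶ X') (t : F₁ ⟶ Spec (.of k))
    (hsq : IsPullback j t (σ' ≫ q) (Spec.map (CommRingCat.ofHom θ))) (x : F₁) (hx : IsClosed ({x} : Set F₁))
    (s : Spec (.of O) ⟶ X') (hs : s ≫ σ' ≫ q = 𝟙 _) (hsx : s (IsLocalRing.closedPoint O) = j x)
    (X₁ : Scheme.{0}) (τ₁ : X₁ ⟶ X') (hτ₁ : IsBlowup τ₁ s.ker) [IsIntegral X₁] [IsLocallyNoetherian X₁]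
    (F₂ : Scheme.{0}) [IsIntegral F₂] (υ : F₂ ⟶ F₁) (hυ : IsBlowup υ (vanishingIdeal (⟨{x}, hx⟩ : Closeds F₁)))
    (j₂ : F₂ ⟶ X₁) (hcomm : j₂ ≫ τ₁ = υ ≫ j)
    -- the letter: the five `LetterDatum` clauses, through the section, not the whole fibre
    (𝓛 : X'.IdealSheafData) (L₁ : Set F₁) (hL₁ : closure L₁ ≠ Set.univ)
    (h1 : 𝓛.comap j = vanishingIdeal (⟨closure L₁, isClosed_closure⟩ : Closeds F₁))
    (h2 : ∀ z : X', (stalkIdeal 𝓛 z).IsPrincipal) (h3 : Scheme.IsRegular 𝓛.subscheme)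
    (h4 : σ' '' (𝓛.support : Set X') ⊆ {y : P | ¬ IsGenericPoint y Y}) (h5 : Flat (𝓛.subschemeι ≫ σ' ≫ q))
    (hle : 𝓛 ≤ s.ker) :
    (strictTransformIdeal τ₁ s.ker 𝓛).comap j₂ =
        vanishingIdeal (⟨closure (closure (υ ⁻¹' (L₁ \ {x}))), isClosed_closure⟩ : Closeds F₂) ∧
      (∀ z : X₁, (stalkIdeal (strictTransformIdeal τ₁ s.ker 𝓛) z).IsPrincipal) ∧
      Scheme.IsRegular (strictTransformIdeal τ₁ s.ker 𝓛).subscheme ∧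
      (τ₁ ≫ σ') '' ((strictTransformIdeal τ₁ s.ker 𝓛).support : Set X₁) ⊆ {y : P | ¬ IsGenericPoint y Y} ∧
      Flat ((strictTransformIdeal τ₁ s.ker 𝓛).subschemeι ≫ (τ₁ ≫ σ') ≫ q) := by
  classical
  obtain ⟨ϖ, hϖ⟩ := IsDiscreteValuationRing.exists_irreducible O
  have hϖO : ϖ ∈ maximalIdeal O := by rw [hϖ.maximalIdeal_eq]; exact Ideal.mem_span_singleton_self ϖ
  have hreg : IsRegularLocalRing (X'.presheaf.stalk (j x)) := hX'reg (j x)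
  haveI := hreg
  -- the model square: `j` is a closed immersion, so `F₁` is locally Noetherian; `F₂` is locally Noetherian over `F₁`
  haveI : IsClosedImmersion (Spec.map (CommRingCat.ofHom θ)) := IsClosedImmersion.spec_of_surjective _ hθ
  haveI : IsClosedImmersion j := MorphismProperty.IsStableUnderBaseChange.of_isPullback hsq.flip inferInstance
  haveI : IsLocallyNoetherian F₁ := LocallyOfFiniteType.isLocallyNoetherian j
  haveI : IsProper υ := hυ.isProper
  haveI : IsLocallyNoetherian F₂ := LocallyOfFiniteType.isLocallyNoetherian υ
  -- the section centre: regular, non-zero, through `j x`; `𝓘(s)·𝒪_{F₁} = 𝓘_{{x}}`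
  obtain ⟨-, hsreg, -, hsupp⟩ := section_isClosedImmersion_and_isRegular_ker O X' (σ' ≫ q) s hs
  obtain ⟨y₁⟩ := (inferInstance : Nonempty F₂)
  have hs0 : s.ker ≠ ⊥ := ne_bot_of_isBlowup hτ₁ (j₂ y₁)
  have hpJ : j x ∈ (s.ker.support : Set X') := by rw [hsupp, ← hsx]; exact Set.mem_range_self _
  have hJ : s.ker.comap j = vanishingIdeal ⟨{x}, hx⟩ :=
    comap_ker_eq_vanishingIdeal_of_model' O k θ hθ (σ' ≫ q) s hs j t hsq x hx hsx hreg
  -- the letter is non-zero (its trace is not the whole fibre)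
  have h𝓛0 : 𝓛 ≠ ⊥ := by
    rintro rfl
    apply hL₁
    have h := congrArg (fun I : F₁.IdealSheafData => ((I.support : Closeds F₁) : Set F₁)) h1
    simp only [Scheme.IdealSheafData.comap_bot, Scheme.IdealSheafData.support_bot, Closeds.coe_top,
      Scheme.IdealSheafData.coe_support_vanishingIdeal] at h
    exact h.symm
  refine ⟨?_, fun z => isPrincipal_stalkIdeal_strictTransformIdeal hX'reg hsreg hτ₁ hs0 𝓛 h2 z, ?_, ?_,
    flat_strictTransform_subschemeι_comp_stage O σ' q τ₁ s.ker hτ₁ 𝓛 h5⟩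
  · -- (l-i) the trace steps as the reduced strict transform of the closed trace
    -- (1) a section frame at `j x`
    obtain ⟨n, c, θR, hcI, hc, hdom, -, h𝔪, hϖc, -⟩ := exists_sectionFrame_forall_dim_at O (σ' ≫ q) s hs (j x) hsx hreg ϖ hϖ
    haveI := hdom
    have hc𝔪 : ∀ i, c i ∈ maximalIdeal (X'.presheaf.stalk (j x)) := fun i => by
      rw [← h𝔪]; exact Ideal.mem_sup_left (Ideal.subset_span ⟨i, rfl⟩)
    have hI𝔪 : Ideal.span (Set.range c) ≤ maximalIdeal _ := Ideal.span_le.mpr (by rintro _ ⟨i, rfl⟩; exact hc𝔪 i)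
    -- (2) the local equation `h` of the letter lies in the section ideal
    obtain ⟨h, hh⟩ := (h2 (j x)).principal
    change stalkIdeal 𝓛 (j x) = Ideal.span {h} at hh
    have h𝓛le : stalkIdeal 𝓛 (j x) ≤ Ideal.span (Set.range c) := hcI ▸ stalkIdeal_mono hle (j x)
    have hhc : h ∈ Ideal.span (Set.range c) := h𝓛le (hh ▸ Ideal.mem_span_singleton_self h)
    have hhm : h ∈ maximalIdeal _ := hI𝔪 hhc
    -- (3) ORDER ONE: `h ≠ 0` and `𝒪_{X',j x}/(h)` regular (`V(𝓛)` regular through `j x`)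
    have hh0 : h ≠ 0 := fun h0 =>
      stalkIdeal_ne_bot_of_ne_bot h𝓛0 (j x) (by rw [hh, h0]; exact Ideal.span_singleton_eq_bot.mpr rfl)
    have hjx : j x ∈ 𝓛.support := Scheme.IdealSheafData.support_antitone hle hpJ
    obtain ⟨hqreg, -⟩ := isRegularLocalRing_quotient_stalkIdeal_of_isRegular 𝓛 h3 hjx
    haveI : IsRegularLocalRing (X'.presheaf.stalk (j x) ⧸ Ideal.span {h}) := by rw [← hh]; exact hqreg
    have hh2 : h ∉ maximalIdeal (X'.presheaf.stalk (j x)) ^ 2 :=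
      Literature.AlgebraicGeometry.Resolution.notMem_sq_of_isRegularLocalRing_quotient hhm hh0
    -- (4) the order-one cone pack of the letter
    have hg : Ideal.span (Set.range fun i => (j.stalkMap x).hom (c i)) ≠ ⊤ := by
      rw [span_stalkMap_eq_maximalIdeal_of_model θ hθ (σ' ≫ q) j t hsq x ϖ hϖO c h𝔪]
      exact (maximalIdeal.isMaximal _).ne_top
    obtain ⟨Φh, hΦh1, hΦhev, hΦhc, hΦhbar⟩ := exists_linearForm_conePack c hc𝔪 hhc hh2 (j.stalkMap x).hom hg
    have hcbar : IsQuasiRegular (fun i => (j.stalkMap x).hom (c i)) :=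
      isQuasiRegular_stalkMap_model O k θ hθ (σ' ≫ q) j t hsq x c hc ϖ hϖ hϖc
    -- (5) F⁺5 for the letter, then the reduced strict transform downstairs
    rw [comap_strictTransformIdeal_eq_of_model τ₁ s.ker 𝓛 hτ₁ j υ j₂ hcomm x hx hυ hJ c hcI hc Φh hΦh1 hΦhc
      (by rw [hΦhev]; exact hh) hcbar hΦhbar, h1, strictTransformIdeal_vanishingIdeal_eq υ _ hυ]
    congr 1
    apply Closeds.ext
    change closure (υ ⁻¹' (closure L₁ \ ((vanishingIdeal (⟨{x}, hx⟩ : Closeds F₁)).support : Set F₁))) =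
      closure (closure (υ ⁻¹' (L₁ \ {x})))
    rw [Scheme.IdealSheafData.coe_support_vanishingIdeal, closure_closure]
    exact closure_preimage_closure_diff_singleton hx hυ L₁
  · -- (l-iii) `V(St 𝓛)` is the blow-up of the regular `V(𝓛)` along the regular centre `V((ker s)·𝒪_{V(𝓛)}) ≅ V(ker s)`
    haveI : IsLocallyNoetherian 𝓛.subscheme := LocallyOfFiniteType.isLocallyNoetherian 𝓛.subschemeι
    obtain ⟨πS, hπS⟩ := exists_hom_subscheme_strictTransformIdeal_of_idealSheaf τ₁ s.ker 𝓛
    exact IsBlowup.isRegular_of_isRegular_subscheme h3 (isRegular_subscheme_comap_subschemeι_of_le hle hsreg)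
      (isBlowup_subscheme_strictTransformIdeal_of_idealSheaf hτ₁ πS hπS)
  · -- (l-iv) off the generic point of `Y`: `supp St 𝓛 ⊆ τ₁⁻¹(supp 𝓛)`
    rintro _ ⟨z, hz, rfl⟩
    have hcl : closure (τ₁ ⁻¹' ((𝓛.support : Set X') \ (s.ker.support : Set X'))) ⊆ τ₁ ⁻¹' (𝓛.support : Set X') :=
      closure_minimal (Set.preimage_mono Set.sdiff_subset) (𝓛.support.isClosed.preimage τ₁.continuous)
    rw [Scheme.Hom.comp_apply]
    exact h4 ⟨τ₁ z, hcl (support_strictTransformIdeal_subset τ₁ s.ker 𝓛 hz), rfl⟩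

/-- **(H4-T) `letter_strictTransform_of_le_ker`.** A model-carrying letter at `(X', σ', j)` through the section (`𝓛 ≤ ker s`,
trace `closure L₁ ≠ F₁`) steps under the section blow-up to the model-carrying letter `St_{τ₁} 𝓛` at `(X₁, τ₁ ≫ σ', j₂)` with
trace `closure υ⁻¹(L₁ ∖ {x})` (`TCPlus.LetterDatum`). [cite: GortzWedhorn2020, Prop. 13.91] [cite: Liu2002, Thm. 8.1.19 (a)]
[OURS · L1 W4.5b · T23-A⁗ (H4-T)] helper toward stmt-ResolutionOfSingularities-20148 (consumed by res-type-027's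
`inv_baseSL_letters`); NOT a statement of the manuscript. -/
theorem letter_strictTransform_of_le_ker (k : Type) [Field k] (O : Type) [CommRing O] [IsDomain O]
    [IsDiscreteValuationRing O] (θ : O →+* k) (hθ : Function.Surjective θ) (P : Scheme.{0}) (q : P ⟶ Spec (.of O)) (Y : Set P)
    (X' : Scheme.{0}) (σ' : X' ⟶ P) [IsIntegral X'] [IsLocallyNoetherian X'] [IsSeparated (σ' ≫ q)] (hX'reg : Scheme.IsRegular X')
    (F₁ : Scheme.{0}) [IsIntegral F₁] (j : F₁ ⟶ X') (t : F₁ ⟶ Spec (.of k))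
    (hsq : IsPullback j t (σ' ≫ q) (Spec.map (CommRingCat.ofHom θ))) (x : F₁) (hx : IsClosed ({x} : Set F₁))
    (s : Spec (.of O) ⟶ X') (hs : s ≫ σ' ≫ q = 𝟙 _) (hsx : s (IsLocalRing.closedPoint O) = j x)
    (X₁ : Scheme.{0}) (τ₁ : X₁ ⟶ X') (hτ₁ : IsBlowup τ₁ s.ker) [IsIntegral X₁] [IsLocallyNoetherian X₁]
    (F₂ : Scheme.{0}) [IsIntegral F₂] (υ : F₂ ⟶ F₁) (hυ : IsBlowup υ (vanishingIdeal (⟨{x}, hx⟩ : Closeds F₁)))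
    (j₂ : F₂ ⟶ X₁) (hcomm : j₂ ≫ τ₁ = υ ≫ j)
    (𝓛 : X'.IdealSheafData) (L₁ : Set F₁) (hL₁ : closure L₁ ≠ Set.univ)
    (h1 : 𝓛.comap j = vanishingIdeal (⟨closure L₁, isClosed_closure⟩ : Closeds F₁))
    (h2 : ∀ z : X', (stalkIdeal 𝓛 z).IsPrincipal) (h3 : Scheme.IsRegular 𝓛.subscheme)
    (h4 : σ' '' (𝓛.support : Set X') ⊆ {y : P | ¬ IsGenericPoint y Y}) (h5 : Flat (𝓛.subschemeι ≫ σ' ≫ q))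
    (hle : 𝓛 ≤ s.ker) :
    TCPlus.LetterDatum O P q Y F₂ X₁ (τ₁ ≫ σ') j₂ (closure (υ ⁻¹' (L₁ \ {x}))) :=
  ⟨strictTransformIdeal τ₁ s.ker 𝓛, letter_strictTransform_clauses_of_le_ker k O θ hθ P q Y X' σ' hX'reg F₁ j t hsq x hx s hs hsx
    X₁ τ₁ hτ₁ F₂ υ hυ j₂ hcomm 𝓛 L₁ hL₁ h1 h2 h3 h4 h5 hle⟩

end Summit.ResolutionOfSingularities.ResolutionOfSingularities.Cruxes.EquisingularLiftNat.Sections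

end
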